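import Mathlib
import Summits.NavierStokesRegularity.NavierStokesRegularity.Theorems.EulerZoomLiouvillePowerGaugeEulerLiouvilleCondenserPolarFrame

/-!
# (Ib) THE CONVECTIVE POLAR IDENTITY — plate t50-Ib of nsreg-p2 ROUND-47 «WHO HOLDS THE RIDGE»
(`r47/Sketch47.lean` sha16 c5b0bf755040b563, text VERBATIM)

Width piece for crux `EulerZoomLiouville.PowerGaugeEulerLiouville` (stmt-NavierStokesRegularity-19832), by name under
LEAD 19832 (ns-typeII-p2 g14) and planner nsreg-p2 g37; seat ns-ezl-w2 g5,
`--supports stmt-NavierStokesRegularity-19832 --as helper`.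

The kinematic heart of the slice radial-momentum identity (ROUND-47 §1).  For a `C¹` planar field `v : ℂ → ℂ` with
`div v = −b` (`div v = Re Dv[1] + Im Dv[i]`) and `0 < δ ≤ d`, in the polar frame `r̂ = e^{iθ}`, `θ̂ = ie^{iθ}`,
`v_r = ⟪v,r̂⟫`, `v_θ = ⟪v,θ̂⟫`:
`(2π)⁻¹ ∫_δ^d ∫_0^{2π} ⟪Dv(z)[v(z)], r̂⟫ dθ dρ = ⨍_{S_d} v_r² − ⨍_{S_δ} v_r² + (2π)⁻¹∫_δ^d∫_0^{2π} v_r b dθ dρ`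
`   + (2π)⁻¹ ∫_δ^d ρ⁻¹ ∫_0^{2π} (v_r² − v_θ²) dθ dρ`.

* `integral_inner_fderiv_self_radial` — the angular integral at a fixed radius `ρ ≠ 0`:
  `∫_0^{2π} ⟪Dv[v], r̂⟫ = 2∫ v_r ∂_ρv_r + ∫ v_r b + ρ⁻¹∫ (v_r² − v_θ²)` (pointwise
  `⟪Dv[v], r̂⟫ = v_r ∂_ρ v_r + v_θ⟪Dv[θ̂], r̂⟫`, `ρ⟪Dv[θ̂], r̂⟫ = ∂_θ v_r − v_θ`; integrate `v_θ ∂_θ v_r` by parts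
  on the circle; `∂_θ v_θ = ρ⟪Dv[θ̂],θ̂⟫ − v_r` and the polar divergence `⟪Dv[θ̂],θ̂⟫ = −b − ∂_ρ v_r`);
* `convectivePolarIdentity_of` — integrate in `ρ ∈ [δ, d]`: the `2∫ v_r ∂_ρ v_r` term is `∂_ρ ∫ v_r²`, handled by
  Fubini (`MeasureTheory.intervalIntegral_intervalIntegral_swap`) and the radial FTC, and `⨍_{S_ρ} v_r²` is the
  circle average of `⟪v z, ‖z‖⁻¹z⟫²`;
* `convectivePolarIdentity` = `NsregP2.R47.ConvectivePolarIdentity` binder-for-binder.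

Physical reading: radial in/out-flow (`v_r² > v_θ²`) HOLDS a central pressure excess, swirl works against it; NO COLUMN
ENTRY of the 3-D gradient occurs (this is a statement about the slice field alone).

HONEST FRAMING: plane calculus; proves nothing about the crux E (19832 OPEN), any door Target, THEOREM K⁗, or
Navier–Stokes regularity; no summit statement is touched. [folklore]
-/

noncomputable section

open Set Filter Topology Metric Function MeasureTheory Complex
open scoped Real RealInnerProductSpace

set_option linter.dupNamespace false

namespace Summit.NavierStokesRegularity.NavierStokesRegularity.Theorems.PowerGaugeEulerLiouville.Condenser

/-! ## §1 The angular integral at a fixed radius -/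

/-- **The convective term around one circle.**  For `v ∈ C¹(ℂ,ℂ)` with `(Dv 1).re + (Dv i).im = −b` and `ρ ≠ 0`:
`∫_0^{2π} ⟪Dv(ρe^{iθ})[v], e^{iθ}⟫ dθ = 2∫_0^{2π} v_r ∂_ρv_r + ∫_0^{2π} v_r b + ρ⁻¹ ∫_0^{2π} (v_r² − v_θ²)`
(`∂_ρ v_r = ⟪Dv[e^{iθ}], e^{iθ}⟫`). [folklore] -/
theorem integral_inner_fderiv_self_radial {v : ℂ → ℂ} {b : ℂ → ℝ} (hv : ContDiff ℝ 1 v) (hb : Continuous b)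
    (hdiv : ∀ z : ℂ, (fderiv ℝ v z 1).re + (fderiv ℝ v z I).im = -b z) {ρ : ℝ} (hρ : ρ ≠ 0) :
    ∫ θ in (0 : ℝ)..2 * π, ⟪fderiv ℝ v (circleMap 0 ρ θ) (v (circleMap 0 ρ θ)), circleMap 0 1 θ⟫ =
      2 * (∫ θ in (0 : ℝ)..2 * π, ⟪v (circleMap 0 ρ θ), circleMap 0 1 θ⟫ *
          ⟪fderiv ℝ v (circleMap 0 ρ θ) (circleMap 0 1 θ), circleMap 0 1 θ⟫) +
        (∫ θ in (0 : ℝ)..2 * π, ⟪v (circleMap 0 ρ θ), circleMap 0 1 θ⟫ * b (circleMap 0 ρ θ)) +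
        ρ⁻¹ * ∫ θ in (0 : ℝ)..2 * π,
          (⟪v (circleMap 0 ρ θ), circleMap 0 1 θ⟫ ^ 2 - ⟪v (circleMap 0 ρ θ), circleMap 0 1 θ * I⟫ ^ 2) := by
  -- names for the five angular functions
  set vr : ℝ → ℝ := fun θ => ⟪v (circleMap 0 ρ θ), circleMap 0 1 θ⟫ with hvr
  set vt : ℝ → ℝ := fun θ => ⟪v (circleMap 0 ρ θ), circleMap 0 1 θ * I⟫ with hvt
  set Drr : ℝ → ℝ := fun θ => ⟪fderiv ℝ v (circleMap 0 ρ θ) (circleMap 0 1 θ), circleMap 0 1 θ⟫ with hDrr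
  set Dtr : ℝ → ℝ := fun θ => ⟪fderiv ℝ v (circleMap 0 ρ θ) (circleMap 0 1 θ * I), circleMap 0 1 θ⟫
    with hDtr
  set Dtt : ℝ → ℝ := fun θ =>
    ⟪fderiv ℝ v (circleMap 0 ρ θ) (circleMap 0 1 θ * I), circleMap 0 1 θ * I⟫ with hDtt
  set bb : ℝ → ℝ := fun θ => b (circleMap 0 ρ θ) with hbb
  have hvd : Differentiable ℝ v := hv.differentiable one_ne_zero
  -- continuity
  obtain ⟨hc1, hcI⟩ := continuous_circleMap_one_frame
  have hcm : Continuous (fun θ : ℝ => circleMap 0 ρ θ) := continuous_circleMap 0 ρ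
  have hvcm : Continuous (fun θ : ℝ => v (circleMap 0 ρ θ)) := hv.continuous.comp hcm
  have hD : Continuous (fun θ : ℝ => fderiv ℝ v (circleMap 0 ρ θ)) :=
    (hv.continuous_fderiv one_ne_zero).comp hcm
  have hvr_c : Continuous vr := hvcm.inner hc1
  have hvt_c : Continuous vt := hvcm.inner hcI
  have hDrr_c : Continuous Drr := (hD.clm_apply hc1).inner hc1
  have hDtr_c : Continuous Dtr := (hD.clm_apply hcI).inner hc1
  have hDtt_c : Continuous Dtt := (hD.clm_apply hcI).inner hcI
  have hbb_c : Continuous bb := hb.comp hcm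
  -- derivatives and periodicity
  have hvr_d : ∀ θ, HasDerivAt vr (ρ * Dtr θ + vt θ) θ := fun θ => hasDerivAt_inner_radial_angle hvd ρ θ
  have hvt_d : ∀ θ, HasDerivAt vt (ρ * Dtt θ - vr θ) θ := fun θ => hasDerivAt_inner_tangential_angle hvd ρ θ
  have hρper := (periodic_circleMap 0 ρ).eq
  have h1per := (periodic_circleMap 0 1).eq
  have hbdry : vt (2 * π) * vr (2 * π) = vt 0 * vr 0 := by
    simp only [hvt, hvr, hρper, h1per]
  -- pointwise identities
  have hconv : ∀ θ, ⟪fderiv ℝ v (circleMap 0 ρ θ) (v (circleMap 0 ρ θ)), circleMap 0 1 θ⟫ =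
      vr θ * Drr θ + vt θ * Dtr θ := fun θ => inner_fderiv_self_radial_eq ρ θ
  have hDtt_eq : ∀ θ, Dtt θ = -bb θ - Drr θ := fun θ => inner_fderiv_tangential_eq_of_div hdiv ρ θ
  -- integration by parts on the circle: `∫ v_θ ∂_θ v_r = −∫ (∂_θ v_θ) v_r`
  have hIBP := intervalIntegral.integral_mul_deriv_eq_deriv_mul (a := 0) (b := 2 * π)
    (fun θ _ => hvt_d θ) (fun θ _ => hvr_d θ)
    (((continuous_const.mul hDtt_c).sub hvr_c).intervalIntegrable _ _)
    (((continuous_const.mul hDtr_c).add hvt_c).intervalIntegrable _ _)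
  rw [hbdry, sub_self, zero_sub] at hIBP
  -- hIBP : ∫ vt (ρ Dtr + vt) = -∫ (ρ Dtt − vr) vr
  set A := ∫ θ in (0 : ℝ)..2 * π, vr θ * Drr θ with hA
  set B := ∫ θ in (0 : ℝ)..2 * π, vr θ * bb θ with hB
  set T := ∫ θ in (0 : ℝ)..2 * π, vt θ * Dtr θ with hT
  set Sr := ∫ θ in (0 : ℝ)..2 * π, vr θ ^ 2 with hSr
  set St := ∫ θ in (0 : ℝ)..2 * π, vt θ ^ 2 with hSt
  have hiA : IntervalIntegrable (fun θ => vr θ * Drr θ) volume 0 (2 * π) :=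
    (hvr_c.mul hDrr_c).intervalIntegrable _ _
  have hiB : IntervalIntegrable (fun θ => vr θ * bb θ) volume 0 (2 * π) := (hvr_c.mul hbb_c).intervalIntegrable _ _
  have hiT : IntervalIntegrable (fun θ => vt θ * Dtr θ) volume 0 (2 * π) :=
    (hvt_c.mul hDtr_c).intervalIntegrable _ _
  have hiSr : IntervalIntegrable (fun θ => vr θ ^ 2) volume 0 (2 * π) := (hvr_c.pow 2).intervalIntegrable _ _
  have hiSt : IntervalIntegrable (fun θ => vt θ ^ 2) volume 0 (2 * π) := (hvt_c.pow 2).intervalIntegrable _ _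
  have hL : ∫ θ in (0 : ℝ)..2 * π, vt θ * (ρ * Dtr θ + vt θ) = ρ * T + St := by
    have e : ∫ θ in (0 : ℝ)..2 * π, vt θ * (ρ * Dtr θ + vt θ) =
        ∫ θ in (0 : ℝ)..2 * π, (ρ * (vt θ * Dtr θ) + vt θ ^ 2) :=
      intervalIntegral.integral_congr fun θ _ => by ring
    rw [e, intervalIntegral.integral_add (hiT.const_mul ρ) hiSt, intervalIntegral.integral_const_mul]
  have hR : ∫ θ in (0 : ℝ)..2 * π, (ρ * Dtt θ - vr θ) * vr θ = -(ρ * B) - ρ * A - Sr := by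
    have e : ∫ θ in (0 : ℝ)..2 * π, (ρ * Dtt θ - vr θ) * vr θ =
        ∫ θ in (0 : ℝ)..2 * π, (-(ρ * (vr θ * bb θ)) - ρ * (vr θ * Drr θ) - vr θ ^ 2) :=
      intervalIntegral.integral_congr fun θ _ => by simp only [hDtt_eq θ]; ring
    have hi1 : IntervalIntegrable (fun θ => -(ρ * (vr θ * bb θ)) - ρ * (vr θ * Drr θ)) volume 0 (2 * π) :=
      (by fun_prop : Continuous fun θ => -(ρ * (vr θ * bb θ)) - ρ * (vr θ * Drr θ)).intervalIntegrable _ _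
    have hi2 : IntervalIntegrable (fun θ => -(ρ * (vr θ * bb θ))) volume 0 (2 * π) :=
      (by fun_prop : Continuous fun θ => -(ρ * (vr θ * bb θ))).intervalIntegrable _ _
    rw [e, intervalIntegral.integral_sub hi1 hiSr, intervalIntegral.integral_sub hi2 (hiA.const_mul ρ),
      intervalIntegral.integral_neg, intervalIntegral.integral_const_mul, intervalIntegral.integral_const_mul]
  rw [hL, hR] at hIBP
  -- hIBP : ρ T + St = -(−ρB − ρA − Sr)
  have hmain : ∫ θ in (0 : ℝ)..2 * π, ⟪fderiv ℝ v (circleMap 0 ρ θ) (v (circleMap 0 ρ θ)), circleMap 0 1 θ⟫ =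
      A + T := by
    rw [intervalIntegral.integral_congr fun θ _ => hconv θ, intervalIntegral.integral_add hiA hiT]
  have hC : ∫ θ in (0 : ℝ)..2 * π, (vr θ ^ 2 - vt θ ^ 2) = Sr - St := intervalIntegral.integral_sub hiSr hiSt
  rw [hmain, hC]
  have hT' : T = B + A + ρ⁻¹ * (Sr - St) := by
    field_simp
    linear_combination hIBP
  rw [hT']
  ring

/-! ## §2 The identity on an annulus -/

/-- The circle average of `⟪v z, ‖z‖⁻¹z⟫²` on `‖z‖ = ρ > 0` is `(2π)⁻¹ ∫_0^{2π} v_r(ρe^{iθ})² dθ`. [folklore] -/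
theorem circleAverage_inner_unit_sq {v : ℂ → ℂ} {ρ : ℝ} (hρ : 0 < ρ) :
    Real.circleAverage (fun z : ℂ => ⟪v z, (‖z‖⁻¹ : ℝ) • z⟫ ^ 2) 0 ρ =
      (2 * π)⁻¹ * ∫ θ in (0 : ℝ)..2 * π, ⟪v (circleMap 0 ρ θ), circleMap 0 1 θ⟫ ^ 2 := by
  rw [Real.circleAverage_def, smul_eq_mul]
  congr 1
  exact intervalIntegral.integral_congr fun θ _ => by simp only [inv_norm_smul_circleMap hρ θ]

/-- **(Ib) THE CONVECTIVE POLAR IDENTITY**, working form.  See the module docstring. [folklore] -/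
theorem convectivePolarIdentity_of {v : ℂ → ℂ} {b : ℂ → ℝ} (hv : ContDiff ℝ 1 v) (hb : Continuous b)
    (hdiv : ∀ z : ℂ, (fderiv ℝ v z 1).re + (fderiv ℝ v z I).im = -b z) {δ d : ℝ} (hδ : 0 < δ)
    (hδd : δ ≤ d) :
    (2 * Real.pi)⁻¹ * (∫ ρ in δ..d, ∫ θ in (0 : ℝ)..2 * Real.pi,
        ⟪fderiv ℝ v (circleMap 0 ρ θ) (v (circleMap 0 ρ θ)), circleMap 0 1 θ⟫) =
      (Real.circleAverage (fun z : ℂ => ⟪v z, (‖z‖⁻¹ : ℝ) • z⟫ ^ 2) 0 d -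
          Real.circleAverage (fun z : ℂ => ⟪v z, (‖z‖⁻¹ : ℝ) • z⟫ ^ 2) 0 δ) +
        (2 * Real.pi)⁻¹ * (∫ ρ in δ..d, ∫ θ in (0 : ℝ)..2 * Real.pi,
          ⟪v (circleMap 0 ρ θ), circleMap 0 1 θ⟫ * b (circleMap 0 ρ θ)) +
        (2 * Real.pi)⁻¹ * (∫ ρ in δ..d, ρ⁻¹ * ∫ θ in (0 : ℝ)..2 * Real.pi,
          (⟪v (circleMap 0 ρ θ), circleMap 0 1 θ⟫ ^ 2 -
            ⟪v (circleMap 0 ρ θ), circleMap 0 1 θ * I⟫ ^ 2)) := by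
  have hvd : Differentiable ℝ v := hv.differentiable one_ne_zero
  have hd : 0 < d := hδ.trans_le hδd
  obtain ⟨hc1, hcI⟩ := continuous_circleMap_one_frame
  -- the three radial integrands as functions of `ρ`
  set A : ℝ → ℝ := fun ρ => ∫ θ in (0 : ℝ)..2 * π, ⟪v (circleMap 0 ρ θ), circleMap 0 1 θ⟫ *
    ⟪fderiv ℝ v (circleMap 0 ρ θ) (circleMap 0 1 θ), circleMap 0 1 θ⟫ with hA
  set B : ℝ → ℝ := fun ρ => ∫ θ in (0 : ℝ)..2 * π, ⟪v (circleMap 0 ρ θ), circleMap 0 1 θ⟫ * b (circleMap 0 ρ θ)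
    with hB
  set C : ℝ → ℝ := fun ρ => ∫ θ in (0 : ℝ)..2 * π,
    (⟪v (circleMap 0 ρ θ), circleMap 0 1 θ⟫ ^ 2 - ⟪v (circleMap 0 ρ θ), circleMap 0 1 θ * I⟫ ^ 2) with hC
  -- joint continuity of the integrands
  have hFA : Continuous fun p : ℝ × ℝ => ⟪v (circleMap 0 p.1 p.2), circleMap 0 1 p.2⟫ *
      ⟪fderiv ℝ v (circleMap 0 p.1 p.2) (circleMap 0 1 p.2), circleMap 0 1 p.2⟫ :=
    (continuous_inner_comp_polar hv.continuous hc1).mul (continuous_inner_fderiv_polar hv hc1 hc1)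
  have hcm2 : Continuous fun p : ℝ × ℝ => circleMap 0 p.1 p.2 := by unfold circleMap; fun_prop
  have hFB : Continuous fun p : ℝ × ℝ => ⟪v (circleMap 0 p.1 p.2), circleMap 0 1 p.2⟫ *
      b (circleMap 0 p.1 p.2) := (continuous_inner_comp_polar hv.continuous hc1).mul (hb.comp hcm2)
  have hFC : Continuous fun p : ℝ × ℝ => ⟪v (circleMap 0 p.1 p.2), circleMap 0 1 p.2⟫ ^ 2 -
      ⟪v (circleMap 0 p.1 p.2), circleMap 0 1 p.2 * I⟫ ^ 2 :=
    ((continuous_inner_comp_polar hv.continuous hc1).pow 2).sub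
      ((continuous_inner_comp_polar hv.continuous hcI).pow 2)
  have hAc : Continuous A := intervalIntegral.continuous_parametric_intervalIntegral_of_continuous' hFA _ _
  have hBc : Continuous B := intervalIntegral.continuous_parametric_intervalIntegral_of_continuous' hFB _ _
  have hCc : Continuous C := intervalIntegral.continuous_parametric_intervalIntegral_of_continuous' hFC _ _
  have hCi : IntervalIntegrable (fun ρ => ρ⁻¹ * C ρ) volume δ d := by
    refine ((continuousOn_inv₀.mono ?_).mul hCc.continuousOn).intervalIntegrable
    intro ρ hρ
    rw [uIcc_of_le hδd] at hρ
    exact ne_of_gt (hδ.trans_le hρ.1)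
  -- step 1: the angular identity inside the radial integral
  have h1 : ∫ ρ in δ..d, ∫ θ in (0 : ℝ)..2 * π,
      ⟪fderiv ℝ v (circleMap 0 ρ θ) (v (circleMap 0 ρ θ)), circleMap 0 1 θ⟫ =
      ∫ ρ in δ..d, (2 * A ρ + B ρ + ρ⁻¹ * C ρ) := by
    refine intervalIntegral.integral_congr fun ρ hρ => ?_
    rw [uIcc_of_le hδd] at hρ
    exact integral_inner_fderiv_self_radial hv hb hdiv (ne_of_gt (hδ.trans_le hρ.1))
  have h2 : ∫ ρ in δ..d, (2 * A ρ + B ρ + ρ⁻¹ * C ρ) =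
      2 * (∫ ρ in δ..d, A ρ) + (∫ ρ in δ..d, B ρ) + ∫ ρ in δ..d, ρ⁻¹ * C ρ := by
    rw [intervalIntegral.integral_add (((hAc.intervalIntegrable _ _).const_mul 2).add
        (hBc.intervalIntegrable _ _)) hCi,
      intervalIntegral.integral_add ((hAc.intervalIntegrable _ _).const_mul 2) (hBc.intervalIntegrable _ _),
      intervalIntegral.integral_const_mul]
  -- step 2: Fubini and the radial FTC for the `A`-term
  have hswap : ∫ ρ in δ..d, A ρ = ∫ θ in (0 : ℝ)..2 * π, ∫ ρ in δ..d,
      ⟪v (circleMap 0 ρ θ), circleMap 0 1 θ⟫ *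
        ⟪fderiv ℝ v (circleMap 0 ρ θ) (circleMap 0 1 θ), circleMap 0 1 θ⟫ := by
    refine MeasureTheory.intervalIntegral_intervalIntegral_swap ?_
    have hK : IsCompact (Icc δ d ×ˢ Icc (0 : ℝ) (2 * π)) := isCompact_Icc.prod isCompact_Icc
    refine (hFA.continuousOn.integrableOn_compact hK).mono_set ?_
    rw [uIoc_of_le hδd, uIoc_of_le (by positivity : (0 : ℝ) ≤ 2 * π)]
    exact Set.prod_mono Ioc_subset_Icc_self Ioc_subset_Icc_self
  have hFTC : ∀ θ : ℝ, ∫ ρ in δ..d, ⟪v (circleMap 0 ρ θ), circleMap 0 1 θ⟫ *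
      ⟪fderiv ℝ v (circleMap 0 ρ θ) (circleMap 0 1 θ), circleMap 0 1 θ⟫ =
      2⁻¹ * (⟪v (circleMap 0 d θ), circleMap 0 1 θ⟫ ^ 2 - ⟪v (circleMap 0 δ θ), circleMap 0 1 θ⟫ ^ 2) := by
    intro θ
    have hρc : Continuous fun ρ : ℝ => circleMap 0 ρ θ := by unfold circleMap; fun_prop
    have hcont : Continuous fun ρ : ℝ => 2 * ⟪v (circleMap 0 ρ θ), circleMap 0 1 θ⟫ *
        ⟪fderiv ℝ v (circleMap 0 ρ θ) (circleMap 0 1 θ), circleMap 0 1 θ⟫ :=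
      (continuous_const.mul ((hv.continuous.comp hρc).inner continuous_const)).mul
        ((((hv.continuous_fderiv one_ne_zero).comp hρc).clm_apply continuous_const).inner continuous_const)
    have h := intervalIntegral.integral_eq_sub_of_hasDerivAt
      (fun ρ _ => hasDerivAt_inner_radial_sq_radius hvd θ ρ) (hcont.intervalIntegrable δ d)
    have e : ∫ ρ in δ..d, 2 * ⟪v (circleMap 0 ρ θ), circleMap 0 1 θ⟫ *
        ⟪fderiv ℝ v (circleMap 0 ρ θ) (circleMap 0 1 θ), circleMap 0 1 θ⟫ =
        2 * ∫ ρ in δ..d, ⟪v (circleMap 0 ρ θ), circleMap 0 1 θ⟫ *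
          ⟪fderiv ℝ v (circleMap 0 ρ θ) (circleMap 0 1 θ), circleMap 0 1 θ⟫ := by
      rw [← intervalIntegral.integral_const_mul]
      exact intervalIntegral.integral_congr fun ρ _ => by ring
    rw [e] at h
    linarith
  have hvr_c : ∀ ρ : ℝ, Continuous fun θ : ℝ => ⟪v (circleMap 0 ρ θ), circleMap 0 1 θ⟫ ^ 2 := fun ρ =>
    ((hv.continuous.comp (continuous_circleMap 0 ρ)).inner hc1).pow 2
  have hA2 : 2 * ∫ ρ in δ..d, A ρ = (∫ θ in (0 : ℝ)..2 * π, ⟪v (circleMap 0 d θ), circleMap 0 1 θ⟫ ^ 2) -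
      ∫ θ in (0 : ℝ)..2 * π, ⟪v (circleMap 0 δ θ), circleMap 0 1 θ⟫ ^ 2 := by
    rw [hswap, intervalIntegral.integral_congr fun θ _ => hFTC θ, intervalIntegral.integral_const_mul,
      intervalIntegral.integral_sub ((hvr_c d).intervalIntegrable _ _) ((hvr_c δ).intervalIntegrable _ _)]
    ring
  -- assemble
  rw [h1, h2, circleAverage_inner_unit_sq hd, circleAverage_inner_unit_sq hδ, mul_add, mul_add, hA2]
  ring

/-- **(Ib) `NsregP2.R47.ConvectivePolarIdentity`, binder-for-binder** (Sketch47 of nsreg-p2 g37, plate t50-Ib).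
For a `C¹` planar field `v` with `div v = −b` and `0 < δ ≤ d`:
`(2π)⁻¹ ∫_δ^d ∫_0^{2π} ⟪Dv(z)[v(z)], r̂⟫ dθ dρ = ⨍_{S_d} v_r² − ⨍_{S_δ} v_r² + (2π)⁻¹∫∫ v_r b + (2π)⁻¹∫ ρ⁻¹∫ (v_r² − v_θ²)`.
The last term is the swirl/strain quadrupole `Q`. [folklore] -/
theorem convectivePolarIdentity :
    ∀ (v : ℂ → ℂ) (b : ℂ → ℝ), ContDiff ℝ 1 v → Continuous b →
      (∀ z : ℂ, (fderiv ℝ v z 1).re + (fderiv ℝ v z Complex.I).im = - b z) →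
      ∀ (δ d : ℝ), 0 < δ → δ ≤ d →
        (2 * Real.pi)⁻¹ * (∫ ρ in δ..d, ∫ θ in (0 : ℝ)..2 * Real.pi,
            ⟪fderiv ℝ v (circleMap 0 ρ θ) (v (circleMap 0 ρ θ)), circleMap 0 1 θ⟫) =
          (Real.circleAverage (fun z : ℂ => ⟪v z, (‖z‖⁻¹ : ℝ) • z⟫ ^ 2) 0 d -
              Real.circleAverage (fun z : ℂ => ⟪v z, (‖z‖⁻¹ : ℝ) • z⟫ ^ 2) 0 δ) +
            (2 * Real.pi)⁻¹ * (∫ ρ in δ..d, ∫ θ in (0 : ℝ)..2 * Real.pi,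
              ⟪v (circleMap 0 ρ θ), circleMap 0 1 θ⟫ * b (circleMap 0 ρ θ)) +
            (2 * Real.pi)⁻¹ * (∫ ρ in δ..d, ρ⁻¹ * ∫ θ in (0 : ℝ)..2 * Real.pi,
              (⟪v (circleMap 0 ρ θ), circleMap 0 1 θ⟫ ^ 2 -
                ⟪v (circleMap 0 ρ θ), circleMap 0 1 θ * Complex.I⟫ ^ 2)) :=
  fun _ _ hv hb hdiv _ _ hδ hδd => convectivePolarIdentity_of hv hb hdiv hδ hδd

end Summit.NavierStokesRegularity.NavierStokesRegularity.Theorems.PowerGaugeEulerLiouville.Condenser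

end
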